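import Summits.ValiantsHypothesis.ValiantsHypothesis.Theorems.SymPencilPerFourPeeledTwoPencilCaseA

/-!
# Route `SymPencil` — inner rank of the `2 | 2` row split of `per_4`, PEELED case: the Case-A
# two-pencil frames have `Q ≠ 0` for free (`--supports` stmt-ValiantsHypothesis-5674
# `SdcSuperquadratic`; (8,8) column, memo `NOTE-p8g15-5674-R2-two-pencil.md` §8; rung currency only)

For the Case-A frame of `…TwoPencilCaseA` (`z₀ = (h₁+τh₂, -h₀, -τh₀, 0)`, `z₁ = (h₂, 0, -h₀, 0)`,
`y_i = a₀ ∘ z_i`) the matrix `Q = P₁₁ - P₁₀ W₀ P₀₁` is LINEAR in `a₁`, vanishes for `a₁ = a₀`, and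
(kit j320792/j320896, exact) its row `3` satisfies
`det(𝐇(z₀)) · a₀₃ a₀ₗ · Q₃ₗ = 4h₀³τ(h₁+τh₂) · Σ_k c̃_{lk} ξ̂_k`, `ξ̂_k = a₁ₖ Π_{m≠k} a₀ₘ`, with the
constant matrix `c̃ = [[0,-A,B,-C],[-A,0,-C,B],[B,-C,0,-A],[-C,B,-A,0]]`, `A = h₀-h₁`, `B = h₀-h₂`,
`C = h₁-h₂`, of rank `3` with kernel `K·𝟙`.  **Theorem** (`caseA_Q_ne_zero`): under the Case-A
hypotheses, `a₀` with non-zero coordinates and `a₁ ∉ K a₀`, the hypothesis `hQ` of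
`…TwoPencilCaseA.false_of_caseA_frame` holds.  Ingredients: the explicit adjugate of `𝐇(z₀)`
(`caseA_adj`), hence an explicit `W₀`, and three explicit entries of `Q`.

Honest framing: infrastructure for the `(8,8,11)` case analysis; no cell closes here; the window
of record, the crux `SdcSuperquadratic` and `VP ≠ VNP` are untouched.  No definitions, no named
facts. [folklore]
-/

noncomputable section

-- single-conjunct layout: Sub = Summit, duplicated namespace component intended
set_option linter.dupNamespace false

namespace Summit.ValiantsHypothesis.ValiantsHypothesis.Theorems.SymPencilPerFourPeeledTwoPencilCaseAQ

open Matrix Finset Module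
open Summit.ValiantsHypothesis.ValiantsHypothesis.Theorems.SymPencilPerFourPeeledTwoPencilSigmaZero
open Summit.ValiantsHypothesis.ValiantsHypothesis.Theorems.SymPencilPerFourPeeledTwoPencilTransport

universe u

variable {K : Type u} [Field K]

/-- **Adjugate of the Case-A Hessian** `𝐇(z₀)`: `ADJ · 𝐇(z₀) = det · 1` with
`det = 4h₀²τ(h₁+τh₂)(h₀τ+h₀-h₁-h₂τ)` (kit j320896, sympy; verified here by `ring`). [folklore] -/
theorem caseA_adj (h : Fin 4 → K) (τ : K) (H₀ : Matrix (Fin 4) (Fin 4) K)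
    (hH₀ : ∀ b l, H₀ b l = if b = l then 0 else
      ((![h 1 + τ * h 2, -h 0, -(τ * h 0), 0] : Fin 4 → K) 0 +
        (![h 1 + τ * h 2, -h 0, -(τ * h 0), 0] : Fin 4 → K) 1 +
        (![h 1 + τ * h 2, -h 0, -(τ * h 0), 0] : Fin 4 → K) 2 +
        (![h 1 + τ * h 2, -h 0, -(τ * h 0), 0] : Fin 4 → K) 3) -
        (![h 1 + τ * h 2, -h 0, -(τ * h 0), 0] : Fin 4 → K) b -
        (![h 1 + τ * h 2, -h 0, -(τ * h 0), 0] : Fin 4 → K) l) :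
    (!![2*h 0^2*h 1*τ + 2*h 0^2*h 2*τ^2 - 2*h 0*h 1^2*τ - 2*h 0*h 1^2 - 4*h 0*h 1*h 2*τ^2 - 4*h 0*h 1*h 2*τ - 2*h 0*h 2^2*τ^3 - 2*h 0*h 2^2*τ^2 + 2*h 1^3 + 6*h 1^2*h 2*τ + 6*h 1*h 2^2*τ^2 + 2*h 2^3*τ^3, -2*h 0^2*h 1 - 2*h 0^2*h 2*τ + 2*h 0*h 1^2 + 4*h 0*h 1*h 2*τ + 2*h 0*h 2^2*τ^2, -2*h 0^2*h 1*τ^2 - 2*h 0^2*h 2*τ^3 + 2*h 0*h 1^2*τ + 4*h 0*h 1*h 2*τ^2 + 2*h 0*h 2^2*τ^3, -2*h 0^2*h 1*τ - 2*h 0^2*h 2*τ^2;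
      -2*h 0^2*h 1 - 2*h 0^2*h 2*τ + 2*h 0*h 1^2 + 4*h 0*h 1*h 2*τ + 2*h 0*h 2^2*τ^2, -2*h 0^3*τ - 2*h 0^3 + 2*h 0^2*h 1*τ + 2*h 0^2*h 1 + 2*h 0^2*h 2*τ^2 + 2*h 0^2*h 2*τ, 2*h 0^3*τ^2 + 2*h 0^3*τ, -2*h 0^2*h 1*τ - 2*h 0^2*h 2*τ^2;
      -2*h 0^2*h 1*τ^2 - 2*h 0^2*h 2*τ^3 + 2*h 0*h 1^2*τ + 4*h 0*h 1*h 2*τ^2 + 2*h 0*h 2^2*τ^3, 2*h 0^3*τ^2 + 2*h 0^3*τ, -2*h 0^3*τ^3 - 2*h 0^3*τ^2 + 2*h 0^2*h 1*τ^2 + 2*h 0^2*h 1*τ + 2*h 0^2*h 2*τ^3 + 2*h 0^2*h 2*τ^2, -2*h 0^2*h 1*τ - 2*h 0^2*h 2*τ^2;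
      -2*h 0^2*h 1*τ - 2*h 0^2*h 2*τ^2, -2*h 0^2*h 1*τ - 2*h 0^2*h 2*τ^2, -2*h 0^2*h 1*τ - 2*h 0^2*h 2*τ^2, 2*h 0^2*h 1*τ + 2*h 0^2*h 2*τ^2] : Matrix (Fin 4) (Fin 4) K) * H₀ =
      (4 * h 0 ^ 2 * τ * (h 1 + h 2 * τ) * (h 0 * τ + h 0 - h 1 - h 2 * τ)) •
        (1 : Matrix (Fin 4) (Fin 4) K) := by
  have e0 : H₀ = !![0, -(τ * h 0), -h 0, -h 0 - τ * h 0;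
                    -(τ * h 0), 0, h 1 + τ * h 2, h 1 + τ * h 2 - τ * h 0;
                    -h 0, h 1 + τ * h 2, 0, h 1 + τ * h 2 - h 0;
                    -h 0 - τ * h 0, h 1 + τ * h 2 - τ * h 0, h 1 + τ * h 2 - h 0, 0] := by
    ext b l; rw [hH₀]
    fin_cases b <;> fin_cases l <;> simp <;> ring
  rw [e0]
  ext i j
  fin_cases i <;> fin_cases j <;> simp [Matrix.mul_apply, Fin.sum_univ_four] <;> ring


/-- Four proportional coordinates: `a₁ = (a₁ 0 / a₀ 0) • a₀`. [folklore] -/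
theorem smul_of_ratios (a₀ a₁ : Fin 4 → K) (ha0 : a₀ 0 ≠ 0)
    (p1 : a₁ 1 * a₀ 0 = a₁ 0 * a₀ 1) (p2 : a₁ 2 * a₀ 0 = a₁ 0 * a₀ 2)
    (p3 : a₁ 3 * a₀ 0 = a₁ 0 * a₀ 3) : a₁ = (a₁ 0 / a₀ 0) • a₀ := by
  funext k
  rw [Pi.smul_apply, smul_eq_mul, div_mul_eq_mul_div, eq_div_iff ha0]
  fin_cases k
  · simp
  · simpa using p1
  · simpa using p2
  · simpa using p3

set_option maxHeartbeats 400000 in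
/-- **`Q ≠ 0` for the Case-A frames** (the hypothesis `hQ` of
`…TwoPencilCaseA.false_of_caseA_frame`), given `a₀` with non-zero coordinates and `a₁ ∉ K a₀`.
[folklore] -/
theorem caseA_Q_ne_zero [CharZero K] (a₀ a₁ : Fin 4 → K) (ha : ∀ k, a₀ k ≠ 0)
    (hind : ∀ μ : K, a₁ ≠ μ • a₀) (h : Fin 4 → K) (τ : K)
    (h0 : h 0 ≠ 0)
    (h01 : h 0 ≠ h 1) (h02 : h 0 ≠ h 2) (h12 : h 1 ≠ h 2)
    (hτ : τ ≠ 0) (hτ1 : h 1 + τ * h 2 ≠ 0) (hτ2 : (h 1 - h 0) + τ * (h 2 - h 0) ≠ 0)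
    (H₀ : Matrix (Fin 4) (Fin 4) K)
    (hH₀ : ∀ b l, H₀ b l = if b = l then 0 else
      ((![h 1 + τ * h 2, -h 0, -(τ * h 0), 0] : Fin 4 → K) 0 +
        (![h 1 + τ * h 2, -h 0, -(τ * h 0), 0] : Fin 4 → K) 1 +
        (![h 1 + τ * h 2, -h 0, -(τ * h 0), 0] : Fin 4 → K) 2 +
        (![h 1 + τ * h 2, -h 0, -(τ * h 0), 0] : Fin 4 → K) 3) -
        (![h 1 + τ * h 2, -h 0, -(τ * h 0), 0] : Fin 4 → K) b -
        (![h 1 + τ * h 2, -h 0, -(τ * h 0), 0] : Fin 4 → K) l) :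
    (Matrix.of fun b l : Fin 4 =>
          (Matrix.of ![a₁, Pi.single b (1 : K),
            (fun k => a₀ k * (![h 2, 0, -h 0, 0] : Fin 4 → K) k), Pi.single l 1]).permanent) -
        (Matrix.of fun b l : Fin 4 =>
          (Matrix.of ![a₀, Pi.single b (1 : K),
            (fun k => a₀ k * (![h 2, 0, -h 0, 0] : Fin 4 → K) k), Pi.single l 1]).permanent) *
        ((a₀ 0 * a₀ 1 * a₀ 2 * a₀ 3)⁻¹ • (Matrix.diagonal a₀ * H₀⁻¹ * Matrix.diagonal a₀)) *
        (Matrix.of fun b l : Fin 4 =>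
          (Matrix.of ![a₁, Pi.single b (1 : K),
            (fun k => a₀ k * (![h 1 + τ * h 2, -h 0, -(τ * h 0), 0] : Fin 4 → K) k),
            Pi.single l 1]).permanent)
        ≠ 0 := by
  intro hQ0
  let z₀ : Fin 4 → K := ![h 1 + τ * h 2, -h 0, -(τ * h 0), 0]
  let z₁ : Fin 4 → K := ![h 2, 0, -h 0, 0]
  let P₁₁ : Matrix (Fin 4) (Fin 4) K := Matrix.of fun b l : Fin 4 =>
    (Matrix.of ![a₁, Pi.single b (1 : K), (fun k => a₀ k * z₁ k), Pi.single l 1]).permanent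
  let P₁₀ : Matrix (Fin 4) (Fin 4) K := Matrix.of fun b l : Fin 4 =>
    (Matrix.of ![a₀, Pi.single b (1 : K), (fun k => a₀ k * z₁ k), Pi.single l 1]).permanent
  let P₀₁ : Matrix (Fin 4) (Fin 4) K := Matrix.of fun b l : Fin 4 =>
    (Matrix.of ![a₁, Pi.single b (1 : K), (fun k => a₀ k * z₀ k), Pi.single l 1]).permanent
  set pa : K := a₀ 0 * a₀ 1 * a₀ 2 * a₀ 3 with hpa
  have hpa0 : pa ≠ 0 := by
    rw [hpa]; exact mul_ne_zero (mul_ne_zero (mul_ne_zero (ha 0) (ha 1)) (ha 2)) (ha 3)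
  let D : Matrix (Fin 4) (Fin 4) K := Matrix.diagonal a₀
  let Di : Matrix (Fin 4) (Fin 4) K := Matrix.diagonal fun k => (a₀ k)⁻¹
  have hDiD : Di * D = 1 := by
    rw [Matrix.diagonal_mul_diagonal, ← Matrix.diagonal_one]
    congr 1; funext k; exact inv_mul_cancel₀ (ha k)
  have hc2 : ∀ X : Matrix (Fin 4) (Fin 4) K, Di * (D * X) = X := fun X => by
    rw [← Matrix.mul_assoc, hDiD, Matrix.one_mul]
  set dt : K := 4 * h 0 ^ 2 * τ * (h 1 + h 2 * τ) * (h 0 * τ + h 0 - h 1 - h 2 * τ) with hdt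
  have hdt0 : dt ≠ 0 := by
    have e1' : h 1 + h 2 * τ ≠ 0 := by rw [mul_comm]; exact hτ1
    have e2' : h 0 * τ + h 0 - h 1 - h 2 * τ ≠ 0 := by
      intro hz; apply hτ2; linear_combination -hz
    rw [hdt]
    exact mul_ne_zero (mul_ne_zero (mul_ne_zero (mul_ne_zero (by norm_num) (pow_ne_zero 2 h0)) hτ)
      e1') e2'
  let ADJ : Matrix (Fin 4) (Fin 4) K := !![2*h 0^2*h 1*τ + 2*h 0^2*h 2*τ^2 - 2*h 0*h 1^2*τ - 2*h 0*h 1^2 - 4*h 0*h 1*h 2*τ^2 - 4*h 0*h 1*h 2*τ - 2*h 0*h 2^2*τ^3 - 2*h 0*h 2^2*τ^2 + 2*h 1^3 + 6*h 1^2*h 2*τ + 6*h 1*h 2^2*τ^2 + 2*h 2^3*τ^3, -2*h 0^2*h 1 - 2*h 0^2*h 2*τ + 2*h 0*h 1^2 + 4*h 0*h 1*h 2*τ + 2*h 0*h 2^2*τ^2, -2*h 0^2*h 1*τ^2 - 2*h 0^2*h 2*τ^3 + 2*h 0*h 1^2*τ + 4*h 0*h 1*h 2*τ^2 + 2*h 0*h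 2^2*τ^3, -2*h 0^2*h 1*τ - 2*h 0^2*h 2*τ^2;
        -2*h 0^2*h 1 - 2*h 0^2*h 2*τ + 2*h 0*h 1^2 + 4*h 0*h 1*h 2*τ + 2*h 0*h 2^2*τ^2, -2*h 0^3*τ - 2*h 0^3 + 2*h 0^2*h 1*τ + 2*h 0^2*h 1 + 2*h 0^2*h 2*τ^2 + 2*h 0^2*h 2*τ, 2*h 0^3*τ^2 + 2*h 0^3*τ, -2*h 0^2*h 1*τ - 2*h 0^2*h 2*τ^2;
        -2*h 0^2*h 1*τ^2 - 2*h 0^2*h 2*τ^3 + 2*h 0*h 1^2*τ + 4*h 0*h 1*h 2*τ^2 + 2*h 0*h 2^2*τ^3, 2*h 0^3*τ^2 + 2*h 0^3*τ, -2*h 0^3*τ^3 - 2*h 0^3*τ^2 + 2*h 0^2*h 1*τ^2 + 2*h 0^2*h 1*τ + 2*h 0^2*h 2*τ^3 + 2*h 0^2*h 2*τ^2, -2*h 0^2*h 1*τ - 2*h 0^2*h 2*τ^2;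
        -2*h 0^2*h 1*τ - 2*h 0^2*h 2*τ^2, -2*h 0^2*h 1*τ - 2*h 0^2*h 2*τ^2, -2*h 0^2*h 1*τ - 2*h 0^2*h 2*τ^2, 2*h 0^2*h 1*τ + 2*h 0^2*h 2*τ^2]
  have hadj : ADJ * H₀ = dt • (1 : Matrix (Fin 4) (Fin 4) K) := caseA_adj h τ H₀ hH₀
  have hinv : H₀⁻¹ = dt⁻¹ • ADJ := by
    refine Matrix.inv_eq_left_inv ?_
    rw [Matrix.smul_mul, hadj, smul_smul, inv_mul_cancel₀ hdt0, one_smul]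
  -- the second Hessian and the transport of `P₁₀`
  let H₁ : Matrix (Fin 4) (Fin 4) K := Matrix.of fun b l : Fin 4 =>
    if b = l then (0 : K) else (z₁ 0 + z₁ 1 + z₁ 2 + z₁ 3) - z₁ b - z₁ l
  have T1 : P₁₀ = pa • (Di * H₁ * Di) := transport_hess a₀ z₁ ha H₁ (fun b l => rfl)
  have hPW : P₁₀ * ((a₀ 0 * a₀ 1 * a₀ 2 * a₀ 3)⁻¹ • (Matrix.diagonal a₀ * H₀⁻¹ * Matrix.diagonal a₀)) =
      dt⁻¹ • (Di * (H₁ * (ADJ * D))) := by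
    rw [T1, hinv, ← hpa]
    show (pa • (Di * H₁ * Di)) * (pa⁻¹ • (D * (dt⁻¹ • ADJ) * D)) = dt⁻¹ • (Di * (H₁ * (ADJ * D)))
    simp only [Matrix.smul_mul, Matrix.mul_smul, smul_smul, Matrix.mul_assoc, hc2]
    have hsc : pa⁻¹ * dt⁻¹ * pa = dt⁻¹ := by field_simp
    rw [hsc]
  -- row `3` of `H₁ · ADJ`, and the explicit permanent entries
  have hrow : ∀ m : Fin 4, (Di * (H₁ * (ADJ * D))) 3 m =
      (a₀ 3)⁻¹ * ((-h 0 * ADJ 0 m + (h 2 - h 0) * ADJ 1 m + h 2 * ADJ 2 m) * a₀ m) := by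
    intro m
    rw [Matrix.diagonal_mul, Matrix.mul_apply]
    simp only [D, Fin.sum_univ_four, Matrix.mul_diagonal]
    have r0 : H₁ 3 0 = -h 0 := by simp [H₁, z₁]
    have r1 : H₁ 3 1 = h 2 - h 0 := by simp [H₁, z₁]; ring
    have r2 : H₁ 3 2 = h 2 := by simp [H₁, z₁]
    have r3 : H₁ 3 3 = 0 := by simp [H₁]
    rw [r0, r1, r2, r3]; ring
  have hP01 : P₀₁ = !![0, -(τ * h 0) * a₀ 2 * a₁ 3, -h 0 * a₀ 1 * a₁ 3,
        -(τ * h 0) * a₀ 2 * a₁ 1 - h 0 * a₀ 1 * a₁ 2;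
      -(τ * h 0) * a₀ 2 * a₁ 3, 0, (h 1 + τ * h 2) * a₀ 0 * a₁ 3,
        -(τ * h 0) * a₀ 2 * a₁ 0 + (h 1 + τ * h 2) * a₀ 0 * a₁ 2;
      -h 0 * a₀ 1 * a₁ 3, (h 1 + τ * h 2) * a₀ 0 * a₁ 3, 0,
        -h 0 * a₀ 1 * a₁ 0 + (h 1 + τ * h 2) * a₀ 0 * a₁ 1;
      -(τ * h 0) * a₀ 2 * a₁ 1 - h 0 * a₀ 1 * a₁ 2, -(τ * h 0) * a₀ 2 * a₁ 0 + (h 1 + τ * h 2) * a₀ 0 * a₁ 2,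
        -h 0 * a₀ 1 * a₁ 0 + (h 1 + τ * h 2) * a₀ 0 * a₁ 1, 0] := by
    ext m l
    simp only [P₀₁, z₀, Matrix.of_apply]
    rw [per_single_mixed]
    fin_cases m <;> fin_cases l <;> simp [Fin.sum_univ_four] <;> ring
  have hP11 : ∀ l : Fin 4, P₁₁ 3 l = (![-h 0 * a₀ 2 * a₁ 1, -h 0 * a₀ 2 * a₁ 0 + h 2 * a₀ 0 * a₁ 2,
      h 2 * a₀ 0 * a₁ 1, 0] : Fin 4 → K) l := by
    intro l
    simp only [P₁₁, z₁, Matrix.of_apply]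
    rw [per_single_mixed]
    fin_cases l <;> simp [Fin.sum_univ_four] <;> ring
  -- the three entries `Q 3 l`, `l = 1, 2, 3`
  have E : ∀ l : Fin 4, P₁₁ 3 l - ∑ m : Fin 4, (dt⁻¹ • (Di * (H₁ * (ADJ * D)))) 3 m * P₀₁ m l = 0 := by
    intro l
    have := congr_fun (congr_fun hQ0 3) l
    rw [Matrix.zero_apply, Matrix.sub_apply, Matrix.mul_apply, hPW] at this
    exact this
  have ha0 := ha 0; have ha1 := ha 1; have ha2 := ha 2; have ha3 := ha 3
  -- generic clearing of denominators in the entries `Q 3 l`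
  have step : ∀ l : Fin 4,
      (P₁₁ 3 l - ∑ m : Fin 4, (dt⁻¹ • (Di * (H₁ * (ADJ * D)))) 3 m * P₀₁ m l) * (dt * a₀ 3 * a₀ l) =
      P₁₁ 3 l * dt * a₀ 3 * a₀ l -
        ∑ m : Fin 4, (-h 0 * ADJ 0 m + (h 2 - h 0) * ADJ 1 m + h 2 * ADJ 2 m) * a₀ m * a₀ l * P₀₁ m l := by
    intro l
    simp only [Matrix.smul_apply, smul_eq_mul, hrow, Finset.sum_mul, sub_mul]
    congr 1
    · ring
    · refine Finset.sum_congr rfl fun m _ => ?_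
      field_simp
  -- explicit adjugate entries
  have hA00 : ADJ 0 0 = 2*h 0^2*h 1*τ + 2*h 0^2*h 2*τ^2 - 2*h 0*h 1^2*τ - 2*h 0*h 1^2 - 4*h 0*h 1*h 2*τ^2 - 4*h 0*h 1*h 2*τ - 2*h 0*h 2^2*τ^3 - 2*h 0*h 2^2*τ^2 + 2*h 1^3 + 6*h 1^2*h 2*τ + 6*h 1*h 2^2*τ^2 + 2*h 2^3*τ^3 := rfl
  have hA01 : ADJ 0 1 = -2*h 0^2*h 1 - 2*h 0^2*h 2*τ + 2*h 0*h 1^2 + 4*h 0*h 1*h 2*τ + 2*h 0*h 2^2*τ^2 := rfl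
  have hA02 : ADJ 0 2 = -2*h 0^2*h 1*τ^2 - 2*h 0^2*h 2*τ^3 + 2*h 0*h 1^2*τ + 4*h 0*h 1*h 2*τ^2 + 2*h 0*h 2^2*τ^3 := rfl
  have hA03 : ADJ 0 3 = -2*h 0^2*h 1*τ - 2*h 0^2*h 2*τ^2 := rfl
  have hA10 : ADJ 1 0 = -2*h 0^2*h 1 - 2*h 0^2*h 2*τ + 2*h 0*h 1^2 + 4*h 0*h 1*h 2*τ + 2*h 0*h 2^2*τ^2 := rfl
  have hA11 : ADJ 1 1 = -2*h 0^3*τ - 2*h 0^3 + 2*h 0^2*h 1*τ + 2*h 0^2*h 1 + 2*h 0^2*h 2*τ^2 + 2*h 0^2*h 2*τ := rfl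
  have hA12 : ADJ 1 2 = 2*h 0^3*τ^2 + 2*h 0^3*τ := rfl
  have hA13 : ADJ 1 3 = -2*h 0^2*h 1*τ - 2*h 0^2*h 2*τ^2 := rfl
  have hA20 : ADJ 2 0 = -2*h 0^2*h 1*τ^2 - 2*h 0^2*h 2*τ^3 + 2*h 0*h 1^2*τ + 4*h 0*h 1*h 2*τ^2 + 2*h 0*h 2^2*τ^3 := rfl
  have hA21 : ADJ 2 1 = 2*h 0^3*τ^2 + 2*h 0^3*τ := rfl
  have hA22 : ADJ 2 2 = -2*h 0^3*τ^3 - 2*h 0^3*τ^2 + 2*h 0^2*h 1*τ^2 + 2*h 0^2*h 1*τ + 2*h 0^2*h 2*τ^3 + 2*h 0^2*h 2*τ^2 := rfl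
  have hA23 : ADJ 2 3 = -2*h 0^2*h 1*τ - 2*h 0^2*h 2*τ^2 := rfl
  -- the cleared entries as linear forms in `ξ̂_k := a₁ k * Π_{m ≠ k} a₀ m`
  have Z : ∀ l : Fin 4, P₁₁ 3 l * dt * a₀ 3 * a₀ l -
      ∑ m : Fin 4, (-h 0 * ADJ 0 m + (h 2 - h 0) * ADJ 1 m + h 2 * ADJ 2 m) * a₀ m * a₀ l * P₀₁ m l = 0 := by
    intro l; rw [← step l, E l, zero_mul]
  have Z1 := Z 1; have Z2 := Z 2; have Z3 := Z 3
  simp only [Fin.sum_univ_four, hP11, hA00, hA01, hA02, hA03, hA10, hA11, hA12, hA13, hA20, hA21,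
    hA22, hA23, hdt] at Z1 Z2 Z3
  rw [hP01] at Z1 Z2 Z3
  simp only [Matrix.of_apply, Matrix.cons_val', Matrix.cons_val_zero, Matrix.cons_val_one,
    Matrix.cons_val_two, Matrix.cons_val_three,
    Matrix.empty_val', Matrix.cons_val_fin_one, Matrix.vecHead, Matrix.vecTail,
    Function.comp_apply, Fin.succ_zero_eq_one, Fin.succ_one_eq_two] at Z1 Z2 Z3
  -- ξ̂-coordinates and their differences
  set x0 : K := a₁ 0 * (a₀ 1 * a₀ 2 * a₀ 3) with hx0
  set x1 : K := a₁ 1 * (a₀ 0 * a₀ 2 * a₀ 3) with hx1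
  set x2 : K := a₁ 2 * (a₀ 0 * a₀ 1 * a₀ 3) with hx2
  set x3 : K := a₁ 3 * (a₀ 0 * a₀ 1 * a₀ 2) with hx3
  -- row l=1: κ(-A x0 - C x2 + B x3) = 0 ; l=2: κ(B x0 - C x1 - A x3) = 0 ; l=3: κ(-C x0 + B x1 - A x2) = 0
  have κ0 : (4 : K) * h 0 ^ 3 * τ * (h 1 + τ * h 2) ≠ 0 :=
    mul_ne_zero (mul_ne_zero (mul_ne_zero (by norm_num) (pow_ne_zero 3 h0)) hτ) hτ1
  have R1 : -(h 0 - h 1) * x0 - (h 1 - h 2) * x2 + (h 0 - h 2) * x3 = 0 := by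
    have : (4 : K) * h 0 ^ 3 * τ * (h 1 + τ * h 2) *
        (-(h 0 - h 1) * x0 - (h 1 - h 2) * x2 + (h 0 - h 2) * x3) = 0 := by
      rw [hx0, hx2, hx3]; linear_combination Z1
    exact (mul_eq_zero.1 this).resolve_left κ0
  have R2 : (h 0 - h 2) * x0 - (h 1 - h 2) * x1 - (h 0 - h 1) * x3 = 0 := by
    have : (4 : K) * h 0 ^ 3 * τ * (h 1 + τ * h 2) *
        ((h 0 - h 2) * x0 - (h 1 - h 2) * x1 - (h 0 - h 1) * x3) = 0 := by
      rw [hx0, hx1, hx3]; linear_combination Z2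
    exact (mul_eq_zero.1 this).resolve_left κ0
  have R3 : -(h 1 - h 2) * x0 + (h 0 - h 2) * x1 - (h 0 - h 1) * x2 = 0 := by
    have : (4 : K) * h 0 ^ 3 * τ * (h 1 + τ * h 2) *
        (-(h 1 - h 2) * x0 + (h 0 - h 2) * x1 - (h 0 - h 1) * x2) = 0 := by
      rw [hx0, hx1, hx2]; linear_combination Z3
    exact (mul_eq_zero.1 this).resolve_left κ0
  -- differences vanish
  have S1 : (h 0 - h 2) * (x3 - x0) - (h 1 - h 2) * (x2 - x0) = 0 := by linear_combination R1
  have S2 : (h 1 - h 2) * (x1 - x0) + (h 0 - h 1) * (x3 - x0) = 0 := by linear_combination -R2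
  have S3 : (h 0 - h 2) * (x1 - x0) - (h 0 - h 1) * (x2 - x0) = 0 := by linear_combination R3
  have hA : h 0 - h 1 ≠ 0 := sub_ne_zero.2 h01
  have hB : h 0 - h 2 ≠ 0 := sub_ne_zero.2 h02
  have hC : h 1 - h 2 ≠ 0 := sub_ne_zero.2 h12
  have T2 : 2 * (h 0 - h 1) * (h 1 - h 2) * (x2 - x0) = 0 := by
    linear_combination (-(h 0 - h 1)) * S1 + (h 0 - h 2) * S2 + (-(h 1 - h 2)) * S3
  have d2 : x2 - x0 = 0 :=
    (mul_eq_zero.1 T2).resolve_left (mul_ne_zero (mul_ne_zero two_ne_zero hA) hC)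
  have d1 : x1 - x0 = 0 := by
    have : (h 0 - h 2) * (x1 - x0) = 0 := by linear_combination S3 + (h 0 - h 1) * d2
    exact (mul_eq_zero.1 this).resolve_left hB
  have d3 : x3 - x0 = 0 := by
    have : (h 0 - h 2) * (x3 - x0) = 0 := by linear_combination S1 + (h 1 - h 2) * d2
    exact (mul_eq_zero.1 this).resolve_left hB
  rw [hx0, hx1] at d1; rw [hx0, hx2] at d2; rw [hx0, hx3] at d3
  -- hence a₁ ∥ a₀
  have p1 : a₁ 1 * a₀ 0 = a₁ 0 * a₀ 1 := by
    have : a₀ 2 * a₀ 3 * (a₁ 1 * a₀ 0 - a₁ 0 * a₀ 1) = 0 := by linear_combination d1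
    have := (mul_eq_zero.1 this).resolve_left (mul_ne_zero ha2 ha3)
    linear_combination this
  have p2 : a₁ 2 * a₀ 0 = a₁ 0 * a₀ 2 := by
    have : a₀ 1 * a₀ 3 * (a₁ 2 * a₀ 0 - a₁ 0 * a₀ 2) = 0 := by linear_combination d2
    have := (mul_eq_zero.1 this).resolve_left (mul_ne_zero ha1 ha3)
    linear_combination this
  have p3 : a₁ 3 * a₀ 0 = a₁ 0 * a₀ 3 := by
    have : a₀ 1 * a₀ 2 * (a₁ 3 * a₀ 0 - a₁ 0 * a₀ 3) = 0 := by linear_combination d3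
    have := (mul_eq_zero.1 this).resolve_left (mul_ne_zero ha1 ha2)
    linear_combination this
  exact hind (a₁ 0 / a₀ 0) (smul_of_ratios a₀ a₁ ha0 p1 p2 p3)

end Summit.ValiantsHypothesis.ValiantsHypothesis.Theorems.SymPencilPerFourPeeledTwoPencilCaseAQ

end
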